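import Summits.NavierStokesRegularity.NavierStokesRegularity.Theorems.WakeRatchetEternalInviscidRateConveyorMassInvariant
import Summits.NavierStokesRegularity.NavierStokesRegularity.Theorems.WakeRatchetRatchetStarvation
import Summits.NavierStokesRegularity.NavierStokesRegularity.Theorems.WakeRatchetTailEnvelopeFinite

/-!
# Dissipation edge (crux `WakeRatchet.EternalViscousRate`, ⟨stmt-NavierStokesRegularity-25647⟩; parent `TailRateRatchet` ⟨25584⟩) —
# THE LEAK RATCHET FOR EVERY COVARIANT VISCOSITY `ν̂ ≥ 0`: `Θ_{n+1} ≤ (1 − e^{−2C_AΛ⁻¹A_{n+1}})·Θ_n`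

Companion of `…EternalInviscidRateLeakRatchet` (inviscid, via the infinite-tail derivative).  Here the same TAIL RATCHET is proved for every
uniformly bounded admissible eternal solution with ANY covariant viscosity `ν̂ ≥ 0` (`IsEternalVisc`), any number of modes `m`, any cancelling
table, any `ε₀ > 0`, using only the tree's FINITE-tail identity `hasDerivAt_tail` (dissipation has the good sign) and a vanishing top-flux
correction:
* `tail_succ_le_leak_visc` — `T_{n+1}(σ) ≤ (1 − e^{−cA})·Θ + e^{−cA}·T_{n+1}(σ₀)` for `σ₀ ≤ σ`, whenever `T_n ≤ Θ` at all log-times and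
  `∫_ℝ‖W_{n+1}‖ ≤ A` (`c = 2C_AΛ⁻¹`).  PROOF: for the truncated tail `T^K_{n+1} = Σ_{j<K}E_{n+1+j}` the functional
  `(Θ − T^K_{n+1})·e^{∫_{σ₀} c‖W_{n+1}‖} + ½γ_K e^{cA}e^{2s}` is non-decreasing on `ℝ` (`γ_K = cB³Λ^{−2(n+K)}` bounds the top flux
  `|F_{n+K}| ≤ γ_K e^{2s}`; the dissipation of the block is `≥ 0`; `F_n ≤ c‖W_{n+1}‖E_n ≤ c‖W_{n+1}‖(Θ − T^K_{n+1})`), and `γ_K → 0`.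
* `tail_succ_le_leak_envelope_visc` — `sup_σ T_{n+1} ≤ (1 − e^{−cA})·Θ`: the inner implication of the route's aside crux `TailRatchet`
  (stmt-21808) and of the viscous child's `stub_inertial` hold for EVERY solution with the SOLUTION-DEPENDENT fraction `w = e^{−2C_AΛ⁻¹M}`
  (not the uniform `w(R)` / rate `(1+ε₀)^{−a}` the cruxes ask: on dissipation-balanced or K41 fronts `M ~ 1/ε₀`).
* `not_survivingFwd_of_leak_visc` / `not_survivingFwd_of_action_lt_log_visc` — fed to the route's landed supports `TailEnvelopeFinite` and
  `RatchetStarvation`: a uniformly bounded admissible eternal solution (any `ν̂ ≥ 0`, `m = 4`) with `2C_AΛ⁻¹M < log(1 + 1/ε₀)` is NOT forward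
  (S₁)-surviving — the LOG-ACTION Liouville regime of K1ᵛ(1) (`NoSurvivingEternalViscBddOne`, stmt-20419), enlarging the tree's `O(1)`
  small-action rung `(2+ε₀)·2C_AΛ⁻¹M < 1`.
MODEL lattice only (Tao 2016 §4 renormalised cascade with the viscous term of the equation before Thm. 4.2); nothing here is a statement about
the Navier–Stokes equations, no stub or crux is closed by this file, no summit is proved.
[cite: Tao2016AveragedNS, §4 Lemma 4.1 (4.8)–(4.10) with the cancellation (4.3) and the viscous equation before Thm. 4.2, §6.4]
-/

noncomputable section

set_option linter.dupNamespace false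

open Filter Topology Set MeasureTheory
open Literature.Analysis.FluidPDE Literature.Analysis.FluidPDE.TaoCascade
open Summit.NavierStokesRegularity.NavierStokesRegularity.Theorems
open Summit.NavierStokesRegularity.NavierStokesRegularity.Cruxes.EternalInviscidRate.FinalWakeLedger

namespace Summit.NavierStokesRegularity.NavierStokesRegularity.Cruxes.EternalViscousRate.DissipationEdge

variable {m : ℕ} {ε₀ νh : ℝ} {α : Fin m → Fin m → Fin m → ℤ × ℤ × ℤ → ℝ} {W : ℤ → ℝ → Em m}

/-- **THE LEAK RATCHET, any covariant viscosity.**  For a uniformly bounded admissible eternal solution of a cancelling table with covariant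
viscosity `ν̂ ≥ 0` (`ε₀ > 0`), a shell `n` whose tail is `≤ Θ` at all log-times, `∫_ℝ ‖W_{n+1}‖ ≤ A`, and `σ₀ ≤ σ`:
`T_{n+1}(σ) ≤ (1 − e^{−2C_AΛ⁻¹A})·Θ + e^{−2C_AΛ⁻¹A}·T_{n+1}(σ₀)`.  MODEL lattice only.
[cite: Tao2016AveragedNS, §4 Lemma 4.1 (4.8)–(4.10), (4.3), the viscous equation before Thm. 4.2, §6.4] -/
theorem tail_succ_le_leak_visc (hε : 0 < ε₀) (hc : IsCancellingCoeff α) (hW : IsEternalVisc ε₀ νh α W)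
    (hU : UniformBound W) (n : ℤ) {Θ : ℝ} (hΘ : ∀ σ : ℝ, ∑' k : ℕ, physEnergy ε₀ W (n + k) σ ≤ Θ)
    {A : ℝ} (hint : Integrable (fun σ => ‖W (n + 1) σ‖)) (hA : ∫ σ, ‖W (n + 1) σ‖ ≤ A)
    {σ₀ σ : ℝ} (hσ : σ₀ ≤ σ) :
    ∑' k : ℕ, physEnergy ε₀ W (n + 1 + k) σ ≤
      (1 - Real.exp (-(2 * fluxConst α * (bigLam ε₀)⁻¹ * A))) * Θ
        + Real.exp (-(2 * fluxConst α * (bigLam ε₀)⁻¹ * A)) * ∑' k : ℕ, physEnergy ε₀ W (n + 1 + k) σ₀ := by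
  have hΛ : 0 < bigLam ε₀ := bigLam_pos (by linarith)
  obtain ⟨B, hB⟩ := hU
  have hU' : UniformBound W := ⟨B, hB⟩
  have hB0 : 0 ≤ B := (norm_nonneg _).trans (hB 0 0)
  have hS : ∀ (n : ℤ) (σ : ℝ), Summable (fun k : ℕ => physEnergy ε₀ W (n + k) σ) :=
    summable_physEnergy_tail_cm hε hU'
  set c : ℝ := 2 * fluxConst α * (bigLam ε₀)⁻¹ with hc_def
  have hc0 : 0 ≤ c := by have := fluxConst_nonneg α; rw [hc_def]; positivity
  -- the full tail above `n+1` and its truncations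
  set T : ℝ → ℝ := fun s => ∑' k : ℕ, physEnergy ε₀ W (n + 1 + k) s with hT
  set TK : ℕ → ℝ → ℝ := fun K s => ∑ j ∈ Finset.range K, physEnergy ε₀ W (n + 1 + j) s with hTK
  have hTK_le : ∀ (K : ℕ) (s : ℝ), TK K s ≤ T s := fun K s =>
    (hS (n + 1) s).sum_le_tsum (Finset.range K) fun j _ => physEnergy_nonneg _ _ _ _
  have hTK_lim : ∀ s, Tendsto (fun K => TK K s) atTop (𝓝 (T s)) := fun s => (hS (n + 1) s).hasSum.tendsto_sum_nat
  -- `T_n = E_n + T_{n+1} ≤ Θ`, so `E_n ≤ Θ − T^K_{n+1}`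
  have hsplit : ∀ s, ∑' k : ℕ, physEnergy ε₀ W (n + k) s = physEnergy ε₀ W n s + T s := by
    intro s
    have h := (hS n s).sum_add_tsum_nat_add 1
    have e : (fun k : ℕ => physEnergy ε₀ W (n + ((k + 1 : ℕ) : ℤ)) s) = fun k : ℕ => physEnergy ε₀ W (n + 1 + k) s := by
      funext k; push_cast; ring_nf
    rw [e, Finset.sum_range_one] at h
    simpa using h.symm
  have hdef : ∀ (K : ℕ) (s : ℝ), physEnergy ε₀ W n s ≤ Θ - TK K s := by
    intro K s; have := hΘ s; rw [hsplit s] at this; linarith [hTK_le K s]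
  have hdefT : ∀ s, 0 ≤ Θ - T s := by
    intro s; have := hΘ s; rw [hsplit s] at this; linarith [physEnergy_nonneg ε₀ W n s]
  -- the leak rate and integrating factor
  set a : ℝ → ℝ := fun s => c * ‖W (n + 1) s‖ with ha
  have ha0 : ∀ s, 0 ≤ a s := fun s => mul_nonneg hc0 (norm_nonneg _)
  have hcontW : Continuous (fun s : ℝ => ‖W (n + 1) s‖) :=
    (continuous_iff_continuousAt.2 fun s => (hW.law (n + 1) s).continuousAt).norm
  have hcont_a : Continuous a := continuous_const.mul hcontW
  have hint_a : Integrable a := hint.const_mul c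
  set I : ℝ → ℝ := fun s => ∫ u in σ₀..s, a u with hI
  have hId : ∀ s, HasDerivAt I (a s) s := fun s => (hcont_a.integral_hasStrictDerivAt σ₀ s).hasDerivAt
  have htot : ∫ u, a u ≤ c * A := by
    calc ∫ u, a u = c * ∫ u, ‖W (n + 1) u‖ := integral_const_mul _ _
      _ ≤ c * A := mul_le_mul_of_nonneg_left hA hc0
  have hcA0 : 0 ≤ c * A := le_trans (integral_nonneg ha0) htot
  have hIle : ∀ s, I s ≤ c * A := by
    intro s
    rcases le_total σ₀ s with h | h
    · simp only [hI]
      rw [intervalIntegral.integral_of_le h]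
      exact (setIntegral_le_integral hint_a (Eventually.of_forall ha0)).trans htot
    · simp only [hI]
      rw [intervalIntegral.integral_symm, intervalIntegral.integral_of_le h]
      have h1 : 0 ≤ ∫ u in Ioc s σ₀, a u := setIntegral_nonneg measurableSet_Ioc fun u _ => ha0 u
      linarith
  -- flux bounds: `F_n ≤ a·E_n`, `|F_{n+K}| ≤ γ_K e^{2s}`
  have hFn : ∀ s, physFlux ε₀ α W n s ≤ a s * physEnergy ε₀ W n s := by
    intro s
    have h := abs_physFlux_le hε hc W n s
    calc physFlux ε₀ α W n s ≤ |physFlux ε₀ α W n s| := le_abs_self _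
      _ ≤ 2 * fluxConst α * (bigLam ε₀)⁻¹ * ‖W (n + 1) s‖ * physEnergy ε₀ W n s := h
      _ = a s * physEnergy ε₀ W n s := by rw [ha]
  set γ : ℕ → ℝ := fun K => c * B * ((bigLam ε₀ ^ (n + K))⁻¹ ^ 2 * B ^ 2) with hγ
  have hγ0 : ∀ K, 0 ≤ γ K := fun K => by simp only [hγ]; positivity
  have hFtop : ∀ (K : ℕ) (s : ℝ), |physFlux ε₀ α W (n + K) s| ≤ γ K * Real.exp (2 * s) := by
    intro K s
    have h := abs_physFlux_le hε hc W (n + K) s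
    have hE : physEnergy ε₀ W (n + K) s ≤ (bigLam ε₀ ^ (n + (K : ℤ)))⁻¹ ^ 2 * B ^ 2 * Real.exp (2 * s) := by
      unfold physEnergy
      have h1 : ‖W (n + K) s‖ ^ 2 ≤ B ^ 2 := pow_le_pow_left₀ (norm_nonneg _) (hB _ _) 2
      have h2 : 0 ≤ (bigLam ε₀ ^ (n + (K : ℤ)))⁻¹ ^ 2 := by positivity
      calc (bigLam ε₀ ^ (n + (K : ℤ)))⁻¹ ^ 2 * (Real.exp (2 * s) * ‖W (n + K) s‖ ^ 2)
          ≤ (bigLam ε₀ ^ (n + (K : ℤ)))⁻¹ ^ 2 * (Real.exp (2 * s) * B ^ 2) :=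
            mul_le_mul_of_nonneg_left (mul_le_mul_of_nonneg_left h1 (Real.exp_pos _).le) h2
        _ = (bigLam ε₀ ^ (n + (K : ℤ)))⁻¹ ^ 2 * B ^ 2 * Real.exp (2 * s) := by ring
    have hWB : ‖W (n + K + 1) s‖ ≤ B := hB _ _
    have hc1 : 0 ≤ 2 * fluxConst α * (bigLam ε₀)⁻¹ := hc0
    calc |physFlux ε₀ α W (n + K) s|
        ≤ 2 * fluxConst α * (bigLam ε₀)⁻¹ * ‖W (n + K + 1) s‖ * physEnergy ε₀ W (n + K) s := h
      _ ≤ 2 * fluxConst α * (bigLam ε₀)⁻¹ * B * ((bigLam ε₀ ^ (n + (K : ℤ)))⁻¹ ^ 2 * B ^ 2 * Real.exp (2 * s)) :=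
          mul_le_mul (mul_le_mul_of_nonneg_left hWB hc1) hE (physEnergy_nonneg _ _ _ _) (by positivity)
      _ = γ K * Real.exp (2 * s) := by simp only [hγ, hc_def]; ring
  -- `γ_K → 0`
  have hγlim : Tendsto γ atTop (𝓝 0) := by
    have hr0 : 0 ≤ ((bigLam ε₀)⁻¹) ^ 2 := by positivity
    have hr1 : ((bigLam ε₀)⁻¹) ^ 2 < 1 := bigLam_ratio_lt_one hε
    have hsplitK : ∀ K : ℕ, (bigLam ε₀ ^ (n + (K : ℤ)))⁻¹ ^ 2 = (bigLam ε₀ ^ n)⁻¹ ^ 2 * (((bigLam ε₀)⁻¹) ^ 2) ^ K := by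
      intro K
      rw [zpow_add₀ hΛ.ne', zpow_natCast, mul_inv, mul_pow]
      congr 1
      rw [← inv_pow, ← pow_mul, ← pow_mul, mul_comm]
    have e : γ = fun K => c * B * ((bigLam ε₀ ^ n)⁻¹ ^ 2 * B ^ 2) * ((((bigLam ε₀)⁻¹) ^ 2) ^ K) := by
      funext K; simp only [hγ]; rw [hsplitK K]; ring
    rw [e]
    have h := (tendsto_pow_atTop_nhds_zero_of_lt_one hr0 hr1).const_mul (c * B * ((bigLam ε₀ ^ n)⁻¹ ^ 2 * B ^ 2))
    rwa [mul_zero] at h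
  -- dissipation of the block is nonnegative
  have hν : 0 ≤ νh := hW.nonneg
  have hvisc0 : ∀ (k : ℤ) (s : ℝ), 0 ≤ viscCoef ε₀ νh k s := by
    intro k s; unfold viscCoef
    have : 0 < (1 + ε₀) ^ ((2 : ℝ) * k) := Real.rpow_pos_of_pos (by linarith) _
    positivity
  have hDK0 : ∀ (K : ℕ) (s : ℝ), 0 ≤ ∑ j ∈ Finset.range K, 2 * viscCoef ε₀ νh (n + 1 + j) s * physEnergy ε₀ W (n + 1 + j) s :=
    fun K s => Finset.sum_nonneg fun j _ => mul_nonneg (mul_nonneg two_pos.le (hvisc0 _ _)) (physEnergy_nonneg _ _ _ _)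
  -- the monotone functionals `G_K`
  have hmono : ∀ K : ℕ, Θ - TK K σ₀ + γ K * Real.exp (c * A) / 2 * Real.exp (2 * σ₀)
      ≤ (Θ - TK K σ) * Real.exp (I σ) + γ K * Real.exp (c * A) / 2 * Real.exp (2 * σ) := by
    intro K
    set G : ℝ → ℝ := fun s => (Θ - TK K s) * Real.exp (I s) + γ K * Real.exp (c * A) / 2 * Real.exp (2 * s) with hG
    have hTKd : ∀ s, HasDerivAt (TK K)
        (physFlux ε₀ α W n s - physFlux ε₀ α W (n + K) s
          - ∑ j ∈ Finset.range K, 2 * viscCoef ε₀ νh (n + 1 + j) s * physEnergy ε₀ W (n + 1 + j) s) s :=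
      fun s => hasDerivAt_tail hε hW hc n K s
    have hexp2 : ∀ s, HasDerivAt (fun s => Real.exp (2 * s)) (Real.exp (2 * s) * 2) s :=
      fun s => ((hasDerivAt_id s).const_mul 2 |>.congr_deriv (by ring)).exp
    have hGd : ∀ s, HasDerivAt G
        (-(physFlux ε₀ α W n s - physFlux ε₀ α W (n + K) s
            - ∑ j ∈ Finset.range K, 2 * viscCoef ε₀ νh (n + 1 + j) s * physEnergy ε₀ W (n + 1 + j) s) * Real.exp (I s)
          + (Θ - TK K s) * (Real.exp (I s) * a s)
          + γ K * Real.exp (c * A) / 2 * (Real.exp (2 * s) * 2)) s :=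
      fun s => (((hTKd s).const_sub Θ).mul (hId s).exp).add ((hexp2 s).const_mul _)
    have hG' : ∀ s, 0 ≤ deriv G s := by
      intro s
      rw [(hGd s).deriv]
      have hexp : 0 < Real.exp (I s) := Real.exp_pos _
      have hexp' : Real.exp (I s) ≤ Real.exp (c * A) := Real.exp_le_exp.2 (hIle s)
      have h1 : physFlux ε₀ α W n s ≤ a s * (Θ - TK K s) :=
        (hFn s).trans (mul_le_mul_of_nonneg_left (hdef K s) (ha0 s))
      have h2 : -(γ K * Real.exp (2 * s)) ≤ physFlux ε₀ α W (n + K) s := by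
        have := neg_abs_le (physFlux ε₀ α W (n + K) s); linarith [hFtop K s]
      have h3 := hDK0 K s
      -- `(−F_n + F_{n+K} + D + a(Θ−T_K)) e^{I} ≥ −γ e^{2s} e^{I} ≥ −γ e^{2s} e^{cA}`
      have h4 : -(γ K * Real.exp (2 * s)) * Real.exp (I s) ≤
          -(physFlux ε₀ α W n s - physFlux ε₀ α W (n + K) s
            - ∑ j ∈ Finset.range K, 2 * viscCoef ε₀ νh (n + 1 + j) s * physEnergy ε₀ W (n + 1 + j) s) * Real.exp (I s)
          + (Θ - TK K s) * (Real.exp (I s) * a s) := by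
        have h5 : -(γ K * Real.exp (2 * s)) ≤
            -(physFlux ε₀ α W n s - physFlux ε₀ α W (n + K) s
              - ∑ j ∈ Finset.range K, 2 * viscCoef ε₀ νh (n + 1 + j) s * physEnergy ε₀ W (n + 1 + j) s)
            + (Θ - TK K s) * a s := by linarith
        have := mul_le_mul_of_nonneg_right h5 hexp.le
        linarith [this]
      have h6 : γ K * Real.exp (2 * s) * Real.exp (I s) ≤ γ K * Real.exp (2 * s) * Real.exp (c * A) :=
        mul_le_mul_of_nonneg_left hexp' (mul_nonneg (hγ0 K) (Real.exp_pos _).le)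
      nlinarith [h4, h6, Real.exp_pos (2 * s), hγ0 K]
    have hGmono : Monotone G := monotone_of_deriv_nonneg (fun s => (hGd s).differentiableAt) hG'
    have h := hGmono hσ
    have hI0 : Real.exp (I σ₀) = 1 := by simp [hI, intervalIntegral.integral_same]
    simp only [hG, hI0, mul_one] at h
    exact h
  -- pass to the limit `K → ∞`
  have hlimL : Tendsto (fun K => Θ - TK K σ₀ + γ K * Real.exp (c * A) / 2 * Real.exp (2 * σ₀)) atTop
      (𝓝 (Θ - T σ₀ + 0 * Real.exp (c * A) / 2 * Real.exp (2 * σ₀))) :=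
    (tendsto_const_nhds.sub (hTK_lim σ₀)).add ((hγlim.mul_const _).div_const _ |>.mul_const _)
  have hlimR : Tendsto (fun K => (Θ - TK K σ) * Real.exp (I σ) + γ K * Real.exp (c * A) / 2 * Real.exp (2 * σ)) atTop
      (𝓝 ((Θ - T σ) * Real.exp (I σ) + 0 * Real.exp (c * A) / 2 * Real.exp (2 * σ))) :=
    ((tendsto_const_nhds.sub (hTK_lim σ)).mul_const _).add ((hγlim.mul_const _).div_const _ |>.mul_const _)
  have hlim : Θ - T σ₀ ≤ (Θ - T σ) * Real.exp (I σ) := by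
    have h := le_of_tendsto_of_tendsto' hlimL hlimR hmono
    simpa using h
  -- conclude as in the inviscid case
  have h1 : Θ - T σ₀ ≤ (Θ - T σ) * Real.exp (c * A) :=
    hlim.trans (mul_le_mul_of_nonneg_left (Real.exp_le_exp.2 (hIle σ)) (hdefT σ))
  have hecA : Real.exp (c * A) * Real.exp (-(c * A)) = 1 := by
    rw [← Real.exp_add, add_neg_cancel, Real.exp_zero]
  have hw0 : 0 < Real.exp (-(c * A)) := Real.exp_pos _
  have h3 : (Θ - T σ₀) * Real.exp (-(c * A)) ≤ Θ - T σ := by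
    have h4 := mul_le_mul_of_nonneg_right h1 hw0.le
    calc (Θ - T σ₀) * Real.exp (-(c * A)) ≤ (Θ - T σ) * Real.exp (c * A) * Real.exp (-(c * A)) := h4
      _ = (Θ - T σ) * (Real.exp (c * A) * Real.exp (-(c * A))) := by ring
      _ = Θ - T σ := by rw [hecA, mul_one]
  show T σ ≤ (1 - Real.exp (-(c * A))) * Θ + Real.exp (-(c * A)) * T σ₀
  linarith [h3]

/-- **The leak ratchet, envelope form, any `ν̂ ≥ 0`:** `T_{n+1}(σ) ≤ (1 − e^{−2C_AΛ⁻¹A})·Θ` for every `σ` — the inner implication of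
`TailRatchet` with the solution-dependent fraction `e^{−2C_AΛ⁻¹A}`.  MODEL lattice only.
[cite: Tao2016AveragedNS, §4 Lemma 4.1 (4.8)–(4.10), (4.3), the viscous equation before Thm. 4.2, §6.4] -/
theorem tail_succ_le_leak_envelope_visc (hε : 0 < ε₀) (hc : IsCancellingCoeff α) (hW : IsEternalVisc ε₀ νh α W)
    (hU : UniformBound W) (n : ℤ) {Θ : ℝ} (hΘ : ∀ σ : ℝ, ∑' k : ℕ, physEnergy ε₀ W (n + k) σ ≤ Θ)
    {A : ℝ} (hint : Integrable (fun σ => ‖W (n + 1) σ‖)) (hA : ∫ σ, ‖W (n + 1) σ‖ ≤ A) (σ : ℝ) :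
    ∑' k : ℕ, physEnergy ε₀ W (n + 1 + k) σ ≤ (1 - Real.exp (-(2 * fluxConst α * (bigLam ε₀)⁻¹ * A))) * Θ := by
  set q : ℝ := Real.exp (-(2 * fluxConst α * (bigLam ε₀)⁻¹ * A)) with hq
  -- tails of a uniformly bounded field vanish in the far past
  have hbot : Tendsto (fun σ₀ => ∑' k : ℕ, physEnergy ε₀ W (n + 1 + k) σ₀) atBot (𝓝 0) := by
    obtain ⟨C, hC⟩ := hU
    set K : ℝ := (bigLam ε₀ ^ (n + 1))⁻¹ ^ 2 * C ^ 2 * (1 - (bigLam ε₀)⁻¹ ^ 2)⁻¹ with hK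
    have hexp : Tendsto (fun σ : ℝ => Real.exp (2 * σ)) atBot (𝓝 0) :=
      Real.tendsto_exp_atBot.comp (tendsto_id.const_mul_atBot (by norm_num : (0 : ℝ) < 2))
    have hmaj : Tendsto (fun σ : ℝ => K * Real.exp (2 * σ)) atBot (𝓝 0) := by
      simpa using hexp.const_mul K
    refine squeeze_zero (fun σ => tsum_nonneg fun k => physEnergy_nonneg _ _ _ _) (fun σ => ?_) hmaj
    calc ∑' k : ℕ, physEnergy ε₀ W (n + 1 + k) σ
        ≤ (bigLam ε₀ ^ (n + 1))⁻¹ ^ 2 * (Real.exp (2 * σ) * C ^ 2) * (1 - (bigLam ε₀)⁻¹ ^ 2)⁻¹ :=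
          WakeRatchetTail.tsum_le_geom hε hC (n + 1) σ
      _ = K * Real.exp (2 * σ) := by rw [hK]; ring
  have hlim : Tendsto (fun σ₀ => (1 - q) * Θ + q * ∑' k : ℕ, physEnergy ε₀ W (n + 1 + k) σ₀) atBot
      (𝓝 ((1 - q) * Θ + q * 0)) := tendsto_const_nhds.add (hbot.const_mul q)
  rw [mul_zero, add_zero] at hlim
  refine ge_of_tendsto hlim ?_
  filter_upwards [eventually_le_atBot σ] with σ₀ hσ₀
  exact tail_succ_le_leak_visc hε hc hW hU n hΘ hint hA hσ₀

/-- **Starvation from the leak ratchet, any `ν̂ ≥ 0` (`m = 4`).**  A uniformly bounded admissible eternal solution of a cancelling table with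
uniform action bound `M` and `(1+ε₀)·(1 − e^{−2C_AΛ⁻¹M}) < 1` is not forward (S₁)-surviving (route supports `TailEnvelopeFinite`,
`RatchetStarvation`).  MODEL lattice only.
[cite: Tao2016AveragedNS, §4 Lemma 4.1 (4.8)–(4.10), (4.3), the viscous equation before Thm. 4.2, §6.4] -/
theorem not_survivingFwd_of_leak_visc {α : Fin 4 → Fin 4 → Fin 4 → ℤ × ℤ × ℤ → ℝ} {W : ℤ → ℝ → Em 4}
    (hε : 0 < ε₀) (hc : IsCancellingCoeff α) (hW : IsEternalVisc ε₀ νh α W) (hU : UniformBound W)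
    {M : ℝ} (hM : ∀ k : ℤ, Integrable (fun σ => ‖W k σ‖) ∧ ∫ σ, ‖W k σ‖ ≤ M)
    (hsmall : (1 + ε₀) * (1 - Real.exp (-(2 * fluxConst α * (bigLam ε₀)⁻¹ * M))) < 1) :
    ¬ EternalSurvivingFwd 1 ε₀ W := by
  set w : ℝ := Real.exp (-(2 * fluxConst α * (bigLam ε₀)⁻¹ * M)) with hw
  have hw0 : 0 < w := Real.exp_pos _
  have hEnv := wakeRatchet_tailEnvelopeFinite_proof ε₀ νh α W hε hc hW hU
  refine wakeRatchet_ratchetStarvation_proof ε₀ w νh α W hε hw0 hsmall hW hU hEnv ?_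
  intro n Θ hΘ σ
  have h := tail_succ_le_leak_envelope_visc hε hc hW hU n hΘ (hM (n + 1)).1 (hM (n + 1)).2 σ
  simpa [hw] using h

/-- **LOG-ACTION LIOUVILLE REGIME, any `ν̂ ≥ 0` (`m = 4`).**  A uniformly bounded admissible eternal solution of a cancelling table whose
uniform action bound satisfies `2C_AΛ⁻¹M < log(1 + 1/ε₀)` is not forward (S₁)-surviving.  MODEL lattice only.
[cite: Tao2016AveragedNS, §4 Lemma 4.1 (4.8)–(4.10), (4.3), the viscous equation before Thm. 4.2, §6.4] -/
theorem not_survivingFwd_of_action_lt_log_visc {α : Fin 4 → Fin 4 → Fin 4 → ℤ × ℤ × ℤ → ℝ} {W : ℤ → ℝ → Em 4}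
    (hε : 0 < ε₀) (hc : IsCancellingCoeff α) (hW : IsEternalVisc ε₀ νh α W) (hU : UniformBound W)
    {M : ℝ} (hM : ∀ k : ℤ, Integrable (fun σ => ‖W k σ‖) ∧ ∫ σ, ‖W k σ‖ ≤ M)
    (hlog : 2 * fluxConst α * (bigLam ε₀)⁻¹ * M < Real.log (1 + 1 / ε₀)) :
    ¬ EternalSurvivingFwd 1 ε₀ W := by
  refine not_survivingFwd_of_leak_visc hε hc hW hU hM ?_
  set κ : ℝ := 2 * fluxConst α * (bigLam ε₀)⁻¹ * M with hκ
  have h1 : 0 < 1 + 1 / ε₀ := by positivity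
  have hexp : ε₀ / (1 + ε₀) < Real.exp (-κ) := by
    have h2 : Real.exp (-Real.log (1 + 1 / ε₀)) = ε₀ / (1 + ε₀) := by
      rw [Real.exp_neg, Real.exp_log h1]
      field_simp
      ring
    rw [← h2]
    exact Real.exp_lt_exp.2 (by linarith)
  have h3 : (1 + ε₀) * (1 - ε₀ / (1 + ε₀)) = 1 := by field_simp; ring
  have h4 : (1 + ε₀) * (1 - Real.exp (-κ)) < (1 + ε₀) * (1 - ε₀ / (1 + ε₀)) :=
    mul_lt_mul_of_pos_left (by linarith) (by linarith)
  linarith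

end Summit.NavierStokesRegularity.NavierStokesRegularity.Cruxes.EternalViscousRate.DissipationEdge

end
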